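import Summits.CriticalPhenomena.PercolationContinuityZ3.Theorems.PercNearOneGluingNoHeavyRsw3AnnulusBlockMeanField
import HarnessLib

/-!
# RSW3 lane (P2, method "3D RSW-lite from continuity"): the SQUARE-ROOT annulus window —
# `P_{p_c}(Λ(L) ↔ ∂ⁱⁿΛ(N) in Λ(N))² ≥ (2d)⁻¹ (L/16N)^{d-1}` for all `1 ≤ L ≤ N`, `d ≥ 2`;
# `d = 3`: `P_{p_c(ℤ³)}(Λ(L) ↔ ∂ⁱⁿΛ(N) in Λ(N)) ≥ L/(40 N)`

builds on p205010 (kernel theorem, internal audit signed; external expert review pending)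

Cell `prim-rsw3` (post-continuity programme, LANE 3 "box crossing / quasi-multiplicativity at
`p_c(ℤ³)`"), prover seat `prim-rsw3-p2` (gen 2), memo `run/shared/lean/prim/rsw3/P2-RSWLITE.md` §7.
Support file (`--supports stmt-CriticalPhenomena-4575`); no definitions, no named facts, no sorries.

With `u_p(L,N) = P_p(boxCrossing d L N) = P_p(Λ(L) ↔ ∂ⁱⁿΛ(N) in Λ(N))`:

* `real_linked_box_sbox_le_sq` — **two-ball bound (all `p`, all `d`)**: if the block `Λ_g(L)` is far
  (`|g_i| > 2r` for some `i`, `L ≤ r`), then `P_p(Λ(L) ↔ Λ_g(L) in Λ(N)) ≤ u_p(L,r)²`: the joining path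
  leaves `Λ(r)` (a `boxCrossing d L r`, read on the edges inside `Λ(r)`) and, read backwards from `Λ_g(L)`,
  leaves `Λ_g(r)` (a translated `boxCrossing d L r`, read inside `Λ_g(r)`); the two balls are disjoint,
  so the events are independent.  No BK here.
* `le_sq_real_boxCrossing_criticalProbI` — **at `p_c(ℤ^d)`, `d ≥ 2`, for all `1 ≤ L ≤ r`:
  `(2d)⁻¹ (L/(16 r))^{d-1} ≤ u_{p_c}(L,r)²`.**  Proof: with `N = 2r + L + 1` the block mean-field bound
  `ψ_{p_c}(L,N) ≥ 1` (`Rsw3.one_le_psi_criticalProbI`, file `…Rsw3AnnulusBlockMeanField`) sums, over at most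
  `2d (4N/L)^{d-1} ≤ 2d (16r/L)^{d-1}` exit blocks `Λ_g(L)` with `|g_i| ≥ N - L = 2r + 1`, terms each
  `≤ u_{p_c}(L,r)²`.  This is the block version of the one-arm bound `π_{p_c}(n)² ≥ c n^{-(d-1)}`
  (`CriticalOneArmBKLowerBound`: `φ_{p_c}(Λ_n) ≥ 1` + BK), and improves the exponent of
  `…Rsw3AnnulusAspectWindow` (`u ≥ (2d)⁻¹ (L/4N)^{d-1}`) by the factor `2`.
* `d = 3` (`le_real_boxCrossing_criticalProbI_three_sqrt`): **`L/(40 N) ≤ P_{p_c(ℤ³)}(Λ(L) ↔ ∂ⁱⁿΛ(N) in Λ(N))`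
  for all `1 ≤ L ≤ N`**; fixed aspect ratio `λ ≥ 1`: `1/(40 λ) ≤ P_{p_c(ℤ³)}(Λ(n) ↔ ∂ⁱⁿΛ(λn) in Λ(λn))` for
  every `n ≥ 1` (`le_real_boxCrossing_mul_criticalProbI_three_sqrt`) — against `1/(96 λ²)` from the plain
  aspect window and the numerically expected `λ^{-0.48}`; aspect `2` (the events of X_B =
  `CritAnnulusNonCrossing`): `≥ 1/80`; defect scale: `u_{p_c}(L,N) ≤ δ ⇒ L ≤ 40 δ N`
  (`le_of_real_boxCrossing_criticalProbI_three_le`).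

Honest size: classical mean-field/finite-size-criterion mathematics (Hammersley, Kesten Thm. 5.1,
Duminil-Copin–Tassion `φ_p(S)`, BK); the uniform two-parameter square-root form and its kernel proof are
the additions; dimension-free, so silent on the hyperscaling side (`SpanningClustersAboveSix`) and on
hard-direction BOX crossings.

References: H. Duminil-Copin, V. Tassion, Comm. Math. Phys. 343 (2016) §1; J. van den Berg, H. Kesten,
J. Appl. Probab. 22 (1985); H. Kesten, *Percolation Theory for Mathematicians* (1982), Thm. 5.1,
Cor. 5.1; G. Grimmett, *Percolation* (1999), §5.2, §11.7. [folklore]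
-/

noncomputable section

namespace Summit.CriticalPhenomena.PercolationContinuityZ3.Theorems

open MeasureTheory ProbabilityTheory Filter Topology
open Literature.Probability.Percolation Literature.Probability.LatticeModels
open Literature.Probability.Percolation.CerfDembinVanishing
open scoped Literature.Probability.Percolation

namespace Rsw3

open SurfaceTension Crossing

variable {d : ℕ}

/-! ## The two-ball bound -/

/-- **Two-ball covering.** If `L ≤ r` and `|g_i| > 2r` for some `i`, then a configuration in which
`Λ(L) ↔ Λ_g(L)` inside `Λ(N)` lies in `boxCrossing d L r` and in the translate at `g` of `boxCrossing d L r`. -/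
theorem linked_box_sbox_subset {L r N : ℕ} {g : Site d} (hLr : L ≤ r) (hg : ∃ i, 2 * (r : ℤ) < |g i|) :
    linked (↑(box d N) : Set (Site d)) (sbox g L) ↑(box d L) ⊆
      boxCrossing d L r ∩
        linked (sbox g r) ((zdShiftIso g) '' ↑(innerBoundary (zdGraph d) (box d r))) (sbox g L) := by
  intro ω hω
  rw [mem_linked_iff] at hω
  obtain ⟨a'', ha'', a, ha, haa⟩ := hω
  rw [Finset.mem_coe] at ha
  obtain ⟨i, hi⟩ := hg
  set H := openGraph ω ⊓ withinGraph (zdGraph d) (↑(box d N) : Set (Site d)) with hHdef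
  have hH : H ≤ zdGraph d := inf_le_right.trans (withinGraph_le _ _)
  have hreach : H.Reachable a'' a := by rw [mem_inConn_iff] at haa; exact haa
  have ha''i : 2 * (r : ℤ) - L < |a'' i| := by
    have h1 := (mem_sbox_iff.1 ha'') i
    have h2 : |g i| - L ≤ |a'' i| := by
      have := abs_sub_abs_le_abs_sub (g i) (a'' i)
      have h3 : |g i - a'' i| ≤ L := by rw [abs_sub_comm]; exact abs_le.2 h1
      linarith
    linarith
  have hai : |a i| ≤ L := abs_le.2 ((mem_box.1 ha) i)
  constructor
  · -- the path leaves `Λ(r)`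
    obtain ⟨W⟩ := hreach.symm
    have haR : a ∈ (↑(box d r) : Set (Site d)) := Finset.mem_coe.2 (box_mono d hLr ha)
    have ha''R : a'' ∉ (↑(box d r) : Set (Site d)) := by
      intro h
      have := abs_le.2 ((mem_box.1 (Finset.mem_coe.1 h)) i)
      have hL0 : (0 : ℤ) ≤ L := by positivity
      linarith
    obtain ⟨b', c', hb', hc', hbc', hr⟩ := exists_exit_of_walk hH (↑(box d r) : Set (Site d)) W haR ha''R
    rw [boxCrossing_eq_linked, mem_linked_iff]
    refine ⟨b', ?_, a, Finset.mem_coe.2 ha, ?_⟩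
    · rw [Finset.mem_coe, mem_innerBoundary_iff]
      exact ⟨Finset.mem_coe.1 hb', c', fun h => hc' (Finset.mem_coe.2 h), hH hbc'⟩
    · rw [mem_inConn_iff]
      exact (hr.mono (le_inf (inf_le_left.trans inf_le_left) inf_le_right)).symm
  · -- read backwards from `Λ_g(L)`, the path leaves `Λ_g(r)`
    obtain ⟨W⟩ := hreach
    have ha''R : a'' ∈ sbox g r := sbox_mono g hLr ha''
    have haR : a ∉ sbox g r := by
      intro h
      have h1 := (mem_sbox_iff.1 h) i
      have h2 : |g i| - |a i| ≤ |a i - g i| := by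
        rw [abs_sub_comm]; exact abs_sub_abs_le_abs_sub (g i) (a i)
      have h3 : |a i - g i| ≤ r := abs_le.2 h1
      have hL0 : (0 : ℤ) ≤ L := by positivity
      linarith
    obtain ⟨e, e', he, he', hee', hr⟩ := exists_exit_of_walk hH (sbox g r) W ha''R haR
    rw [mem_linked_iff]
    refine ⟨e, ?_, a'', ha'', ?_⟩
    · refine ⟨e - g, ?_, by simp [zdShiftIso_apply]⟩
      rw [Finset.mem_coe, mem_innerBoundary_iff]
      have hbox : e - g ∈ box d r := by
        rw [mem_box]; intro j; simpa only [Pi.sub_apply] using (mem_sbox_iff.1 he) j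
      refine ⟨hbox, e' - g, fun he2 => he' ?_, ?_⟩
      · rw [mem_sbox_iff]; intro j; simpa only [Pi.sub_apply] using (mem_box.1 he2) j
      · have hG : (zdGraph d).Adj e e' := hH hee'
        rw [← zdGraph_adj_shift_iff g, Site.shift_apply, Site.shift_apply, sub_add_cancel,
          sub_add_cancel]
        exact hG
    · rw [mem_inConn_iff]
      exact (hr.mono (le_inf (inf_le_left.trans inf_le_left) inf_le_right)).symm

/-- **Two-ball bound (all `p`, all `d`).** If `L ≤ r` and `|g_i| > 2r` for some `i`, then
`P_p(Λ(L) ↔ Λ_g(L) in Λ(N)) ≤ u_p(L,r)²` (independence of the crossings of the disjoint balls `Λ(r)`,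
`Λ_g(r)`). -/
theorem real_linked_box_sbox_le_sq (p : unitInterval) {L r N : ℕ} {g : Site d} (hLr : L ≤ r)
    (hg : ∃ i, 2 * (r : ℤ) < |g i|) :
    (bondPercolation (zdGraph d) p).real (linked (↑(box d N) : Set (Site d)) (sbox g L) ↑(box d L)) ≤
      (bondPercolation (zdGraph d) p).real (boxCrossing d L r) ^ 2 := by
  have hdisj : Disjoint (↑(box d r) : Set (Site d)) (sbox g r) := by
    obtain ⟨i, hi⟩ := hg
    rw [Set.disjoint_left]
    intro x hx hx'
    have h1 := abs_le.2 ((mem_box.1 (Finset.mem_coe.1 hx)) i)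
    have h2 : |x i - g i| ≤ r := abs_le.2 ((mem_sbox_iff.1 hx') i)
    have h3 : |g i| ≤ |x i| + |x i - g i| := by
      have := abs_sub_abs_le_abs_sub (g i) (x i)
      rw [abs_sub_comm] at h2 ⊢
      linarith [abs_sub_abs_le_abs_sub (g i) (x i)]
    linarith
  have hA : DeterminedBy (boxCrossing d L r)
      (withinGraph (zdGraph d) (↑(box d r) : Set (Site d))).edgeSet := by
    rw [boxCrossing_eq_linked]; exact determinedBy_linked _ _ _
  calc (bondPercolation (zdGraph d) p).real (linked (↑(box d N) : Set (Site d)) (sbox g L) ↑(box d L))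
      ≤ (bondPercolation (zdGraph d) p).real (boxCrossing d L r ∩
          linked (sbox g r) ((zdShiftIso g) '' ↑(innerBoundary (zdGraph d) (box d r))) (sbox g L)) :=
        measureReal_mono (linked_box_sbox_subset hLr hg) (measure_ne_top _ _)
    _ = (bondPercolation (zdGraph d) p).real (boxCrossing d L r) *
          (bondPercolation (zdGraph d) p).real
            (linked (sbox g r) ((zdShiftIso g) '' ↑(innerBoundary (zdGraph d) (box d r))) (sbox g L)) :=
        bondPercolation_real_inter_of_disjoint (zdGraph d) p (disjoint_edgeSet_withinGraph hdisj) hA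
          (determinedBy_linked _ _ _) (measurableSet_boxCrossing L r) (measurableSet_linked _ _ _)
    _ = (bondPercolation (zdGraph d) p).real (boxCrossing d L r) ^ 2 := by
        rw [real_sCrossAt_eq, sq]

/-! ## The square-root window at `p_c` -/

/-- **The square-root annulus window at `p_c(ℤ^d)`, `d ≥ 2`:** for all `1 ≤ L ≤ r`,
`(2d)⁻¹ (L/(16 r))^{d-1} ≤ P_{p_c}(Λ(L) ↔ ∂ⁱⁿΛ(r) in Λ(r))²`. [cite: Kesten1982, Cor. 5.1] -/
theorem le_sq_real_boxCrossing_criticalProbI (hd : 2 ≤ d) {L r : ℕ} (hL : 1 ≤ L) (hLr : L ≤ r) :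
    (2 * (d : ℝ))⁻¹ * ((L : ℝ) / (16 * r)) ^ (d - 1) ≤
      (bondPercolation (zdGraph d) (criticalProbI d)).real (boxCrossing d L r) ^ 2 := by
  classical
  set N := 2 * r + L + 1 with hN
  have hLN : L ≤ N := by omega
  have hN1 : 1 ≤ N := by omega
  set G := innerBoundary (zdGraph d) (box d ((N + L) / (2 * L + 1))) with hG
  set u : ℝ := (bondPercolation (zdGraph d) (criticalProbI d)).real (boxCrossing d L r) with hu
  have hsum : 1 ≤ ∑ k ∈ G, (bondPercolation (zdGraph d) (criticalProbI d)).real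
      (linked (↑(box d N) : Set (Site d)) (sbox (gridPt L k) L) ↑(box d L)) :=
    one_le_psi_criticalProbI hd hLN hN1
  have hterm : ∀ k ∈ G, (bondPercolation (zdGraph d) (criticalProbI d)).real
      (linked (↑(box d N) : Set (Site d)) (sbox (gridPt L k) L) ↑(box d L)) ≤ u ^ 2 := by
    intro k hk
    refine real_linked_box_sbox_le_sq (criticalProbI d) hLr ?_
    obtain ⟨i, hi⟩ := exists_abs_gridPt_ge hk
    refine ⟨i, lt_of_lt_of_le ?_ hi⟩
    rw [hN]; push_cast; linarith
  have hcard : (G.card : ℝ) ≤ 2 * d * (4 * (N : ℝ) / L) ^ (d - 1) :=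
    card_innerBoundary_gridBox_le' hL hLN
  have hL0 : (0 : ℝ) < L := by exact_mod_cast hL
  have hr0 : (0 : ℝ) < r := by exact_mod_cast (lt_of_lt_of_le hL hLr)
  have hNr : 4 * (N : ℝ) / L ≤ 16 * (r : ℝ) / L := by
    rw [div_le_div_iff_of_pos_right hL0]
    have : (N : ℝ) = 2 * r + L + 1 := by rw [hN]; push_cast; ring
    rw [this]
    have h1 : (L : ℝ) ≤ r := by exact_mod_cast hLr
    have h2 : (1 : ℝ) ≤ r := by exact_mod_cast (le_trans hL hLr)
    linarith
  have h1 : (1 : ℝ) ≤ 2 * d * (16 * (r : ℝ) / L) ^ (d - 1) * u ^ 2 :=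
    calc (1 : ℝ) ≤ ∑ k ∈ G, (bondPercolation (zdGraph d) (criticalProbI d)).real
          (linked (↑(box d N) : Set (Site d)) (sbox (gridPt L k) L) ↑(box d L)) := hsum
      _ ≤ ∑ _k ∈ G, u ^ 2 := Finset.sum_le_sum hterm
      _ = G.card * u ^ 2 := by rw [Finset.sum_const, nsmul_eq_mul]
      _ ≤ 2 * d * (4 * (N : ℝ) / L) ^ (d - 1) * u ^ 2 :=
          mul_le_mul_of_nonneg_right hcard (sq_nonneg _)
      _ ≤ 2 * d * (16 * (r : ℝ) / L) ^ (d - 1) * u ^ 2 := by gcongr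
  have hCpos : (0 : ℝ) < 2 * d * (16 * (r : ℝ) / L) ^ (d - 1) := by
    have : (0 : ℝ) < d := by exact_mod_cast (lt_of_lt_of_le (by norm_num : 0 < 2) hd)
    positivity
  have hCinv : (2 * (d : ℝ))⁻¹ * ((L : ℝ) / (16 * r)) ^ (d - 1) =
      (2 * d * (16 * (r : ℝ) / L) ^ (d - 1))⁻¹ := by
    rw [← inv_div (16 * (r : ℝ)) L, inv_pow, ← mul_inv]
  rw [hCinv, inv_le_iff_one_le_mul₀ hCpos]
  linarith

/-- **`d = 3`: `L/(40 N) ≤ P_{p_c(ℤ³)}(Λ(L) ↔ ∂ⁱⁿΛ(N) in Λ(N))` for all `1 ≤ L ≤ N`** (from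
`u² ≥ (L/16N)²/6` and `40² ≥ 6 · 16²`). [cite: Kesten1982, Cor. 5.1] -/
theorem le_real_boxCrossing_criticalProbI_three_sqrt {L N : ℕ} (hL : 1 ≤ L) (hLN : L ≤ N) :
    (L : ℝ) / (40 * N) ≤ (bondPercolation (zdGraph 3) (criticalProbI 3)).real (boxCrossing 3 L N) := by
  have h := le_sq_real_boxCrossing_criticalProbI (d := 3) (by norm_num) hL hLN
  set u : ℝ := (bondPercolation (zdGraph 3) (criticalProbI 3)).real (boxCrossing 3 L N) with hu
  have hu0 : 0 ≤ u := measureReal_nonneg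
  have hN0 : (0 : ℝ) < N := by exact_mod_cast (lt_of_lt_of_le hL hLN)
  have hL0 : (0 : ℝ) ≤ L := by positivity
  have h2 : ((L : ℝ) / (40 * N)) ^ 2 ≤ u ^ 2 := by
    refine le_trans ?_ h
    have e1 : ((L : ℝ) / (40 * N)) ^ 2 = (L : ℝ) ^ 2 / (N : ℝ) ^ 2 * (1 / 1600) := by
      field_simp
      ring
    have e2 : (2 * ((3 : ℕ) : ℝ))⁻¹ * ((L : ℝ) / (16 * N)) ^ (3 - 1) =
        (L : ℝ) ^ 2 / (N : ℝ) ^ 2 * (1 / 1536) := by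
      norm_num
      field_simp
      ring
    rw [e1, e2]
    exact mul_le_mul_of_nonneg_left (by norm_num) (by positivity)
  exact (pow_le_pow_iff_left₀ (by positivity) hu0 two_ne_zero).1 h2

/-- **`d = 3`, fixed aspect ratio:** `1/(40 λ) ≤ P_{p_c(ℤ³)}(Λ(n) ↔ ∂ⁱⁿΛ(λn) in Λ(λn))` for all `λ, n ≥ 1`
(`λ = 2`, the events of X_B = `CritAnnulusNonCrossing`: `≥ 1/80`; `λ = 4`, the tree's window: `≥ 1/160`
against `85^{-3}`). [cite: Kesten1982, Cor. 5.1] -/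
theorem le_real_boxCrossing_mul_criticalProbI_three_sqrt {lam n : ℕ} (hlam : 1 ≤ lam) (hn : 1 ≤ n) :
    (40 * (lam : ℝ))⁻¹ ≤
      (bondPercolation (zdGraph 3) (criticalProbI 3)).real (boxCrossing 3 n (lam * n)) := by
  have h := le_real_boxCrossing_criticalProbI_three_sqrt hn (Nat.le_mul_of_pos_left n hlam)
  have hn0 : (n : ℝ) ≠ 0 := by exact_mod_cast (by omega : n ≠ 0)
  have heq : (n : ℝ) / (40 * ((lam * n : ℕ) : ℝ)) = (40 * (lam : ℝ))⁻¹ := by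
    push_cast
    field_simp
  rwa [heq] at h

/-- **`d = 3`, defect scale:** if `P_{p_c(ℤ³)}(Λ(L) ↔ ∂ⁱⁿΛ(N) in Λ(N)) ≤ δ` (`1 ≤ L ≤ N`) then
`L ≤ 40 δ N`; i.e. LANE 1's defect scale satisfies `F(L) ≥ L/(40(1-δ'))` at crossing level `1 - δ'`.
[cite: Kesten1982, Cor. 5.1] -/
theorem le_of_real_boxCrossing_criticalProbI_three_le {L N : ℕ} (hL : 1 ≤ L) (hLN : L ≤ N) {δ : ℝ}
    (hδ : (bondPercolation (zdGraph 3) (criticalProbI 3)).real (boxCrossing 3 L N) ≤ δ) :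
    (L : ℝ) ≤ 40 * δ * N := by
  have h := (le_real_boxCrossing_criticalProbI_three_sqrt hL hLN).trans hδ
  have hN0 : (0 : ℝ) < N := by exact_mod_cast (lt_of_lt_of_le hL hLN)
  rw [div_le_iff₀ (by positivity)] at h
  linarith

/-- **General `d ≥ 2`, fixed aspect ratio:** `(2d)⁻¹ (16 λ)^{-(d-1)} ≤ P_{p_c}(Λ(n) ↔ ∂ⁱⁿΛ(λn) in Λ(λn))²`
for all `λ, n ≥ 1`. [cite: Kesten1982, Cor. 5.1] -/
theorem le_sq_real_boxCrossing_mul_criticalProbI (hd : 2 ≤ d) {lam n : ℕ} (hlam : 1 ≤ lam)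
    (hn : 1 ≤ n) :
    (2 * (d : ℝ))⁻¹ * ((16 * (lam : ℝ)) ^ (d - 1))⁻¹ ≤
      (bondPercolation (zdGraph d) (criticalProbI d)).real (boxCrossing d n (lam * n)) ^ 2 := by
  have h := le_sq_real_boxCrossing_criticalProbI hd hn (Nat.le_mul_of_pos_left n hlam)
  have hn0 : (n : ℝ) ≠ 0 := by exact_mod_cast (by omega : n ≠ 0)
  have heq : ((n : ℝ) / (16 * ((lam * n : ℕ) : ℝ))) = (16 * (lam : ℝ))⁻¹ := by
    push_cast
    field_simp
  rwa [heq, inv_pow] at h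

end Rsw3

end Summit.CriticalPhenomena.PercolationContinuityZ3.Theorems

end
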